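import Literature.Dynamics.Hyperbolic.CLPPseudoOrbitBlocks
import Literature.Dynamics.Hyperbolic.CLPBlockSequence
import Literature.Dynamics.Hyperbolic.SequenceShadowingUniqueness

/-!
# Proof of the Chow–Lin–Palmer shadowing lemma (Pilyugin 1999, §1.3.4)

Topic `Literature/Dynamics/Hyperbolic`.  DISCHARGES the named fact `ChowLinPalmerShadowing`
(`Literature/Dynamics/Hyperbolic/ChowLinPalmerShadowing.lean`): for a `C¹` map `ψ` of a Banach space and a positively
invariant set `T` carrying a Chow–Lin–Palmer hyperbolic structure (conditions (1)–(5), Pilyugin1999 (1.86)–(1.88)), there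
is `ε₀ > 0` such that for every `ε ∈ (0, ε₀)` some `d > 0` makes every `d`-pseudo-orbit in `T` `ε`-shadowed by a UNIQUE
true orbit ((1.89)–(1.90); no invertibility of `ψ`, no finite-dimensionality).

## Proof (Pilyugin's reduction, LNM 1706 pp. 45–47, followed step by step)

1. Constants: `N₀ = max N 1`, `L ≥ 1` the derivative bound of condition (5) (`IsCLPHyperbolicSet.exists_fderiv_bound`), the block length `ν` with
   `N₀⁴λ^ν ≤ 1/24` (Pilyugin's (1.91) `Nλ^ν ≤ λ`, sharpened so that all the block constants below are absolute), the two
   uniform moduli `δ₁, δ₂` of `x ↦ D(ψ^ν)(x)` at `T` for the tolerances `1/(24N₀)`, `1/(24N₀³)`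
   (`IsCLPHyperbolicSet.fderiv_iterate_modulus`); `ε₀ := δ₁`; given `ε < ε₀`,
   `d := min (Δ/L₁) (δ₁/(8N₀L₁)) (δ₂/(L^ν L₁)) (ε/L₂)`, `L₁ = νL^ν`, `L₂ = 8N₀L^ν L₁ + L₁` (Pilyugin's `d₁`, `L₂`).
2. Block data of a `d`-pseudo-orbit `y ⊆ T`: `ξ_m = y_{mν}`, arrival points `xs_m = ψ^ν(y_{(m-1)ν}) ∈ T`,
   `‖xs_m - ξ_m‖ ≤ L₁ d` (Lemma 1.1.3), hence the derivative closeness and, by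
   `IsCLPHyperbolicSet.norm_Q_P_apply_le`, the `½`-smallness of the cross projections at the junction points
   `ψ^ν(xs_m)`, `xs_{m+1}`; `IsCLPHyperbolicSet.exists_blockSequence` then yields the `(½, N₀)`-hyperbolic sequence
   `(A, P ∘ xs, B)` with (b') ("analogs of conditions (a) and (b) of Theorem 1.3.1 are satisfied").
3. The block maps `φ_m(v) = Ψ(ξ_m + v) - ξ_{m+1}` satisfy `‖φ_m(0)‖ ≤ L₁ d` and the Lipschitz estimate (1.54) for
   `φ_m - A_m` on the `δ₁`-ball with `κ = 5/(24N₀)`, `κN₁ = 5/8 < 1` (`N₁ = 3N₀`, `L = 8N₀` for `λ' = ½`): mean value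
   remainder + derivative closeness + `‖D(ψ^ν)(xs_m) - A_m‖ ≤ 3/(24N₀)`.
4. Theorem 1.3.1 (`IsHyperbolicSequence.exists_shadow`) gives `v` with `‖v_m‖ ≤ 8N₀L₁d`, `Ψ(z_m) = z_{m+1}` for
   `z_m = ξ_m + v_m` ((1.92)); interpolation `x_k = ψ^{k₁}(z_{k₀})`, `k = k₀ν + k₁` (formula (1.4)) is an orbit with
   `‖x_k - y_k‖ ≤ L^ν · 8N₀L₁d + L₁d = L₂ d ≤ ε` (Lemma 1.1.3 (2)).
5. Uniqueness: an orbit `x'` `ε`-shadowing `y` gives the `φ`-trajectory `v'_m = x'_{mν} - ξ_m` in the `δ₁`-ball, so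
   `v' = v` by Theorem 1.3.2 in the form `IsHyperbolicSequence.shadow_unique` (exponential dichotomy variant under
   (b), (b')), and an orbit is determined by its values at the block starts.

The continuity of the splitting (fields `continuousOn_P`, `continuousOn_Q`) is not used: see the design note in
`CLPBlockSequence.lean`.

## References

* S. Yu. Pilyugin, *Shadowing in Dynamical Systems*, LNM 1706, Springer (1999), §1.3.4 "Theorems of Chow–Lin–Palmer
  and Steinlein–Walther", pp. 45–47, (1.86)–(1.92); Theorems 1.3.1, 1.3.2; Lemma 1.1.3. [Pilyugin1999]
* S.-N. Chow, X.-B. Lin, K. J. Palmer, *A shadowing lemma with applications to semilinear parabolic equations*,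
  SIAM J. Math. Anal. 20 (1989) 547–557. [ChowLinPalmer1989]
-/

noncomputable section

open Set Function Metric
open scoped Topology

namespace Literature.Dynamics.Hyperbolic

variable {E : Type*} [NormedAddCommGroup E] [NormedSpace ℝ E]

section Main

/-- Arithmetic of the constants: with `N₀ ≥ 1`, `0 ≤ t`, `N₀⁴ t ≤ 1/24` one has `N₀³ t ≤ 1/24`, `N₀² t ≤ 1/24`.
[folklore] -/
theorem pow_mul_le_aux {N₀ t : ℝ} (hN₀ : 1 ≤ N₀) (ht : 0 ≤ t) (h4 : N₀ ^ 4 * t ≤ 1 / 24) :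
    N₀ ^ 3 * t ≤ 1 / 24 ∧ N₀ ^ 2 * t ≤ 1 / 24 ∧ N₀ * t ≤ 1 / 24 := by
  have h3 : N₀ ^ 3 * t ≤ N₀ ^ 4 * t :=
    mul_le_mul_of_nonneg_right (pow_le_pow_right₀ hN₀ (by norm_num)) ht
  have h2 : N₀ ^ 2 * t ≤ N₀ ^ 4 * t :=
    mul_le_mul_of_nonneg_right (pow_le_pow_right₀ hN₀ (by norm_num)) ht
  have h1 : N₀ * t ≤ N₀ ^ 4 * t := by
    have := mul_le_mul_of_nonneg_right (pow_le_pow_right₀ hN₀ (show 1 ≤ 4 by norm_num)) ht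
    simpa using this
  exact ⟨h3.trans h4, h2.trans h4, h1.trans h4⟩

set_option maxHeartbeats 800000 in -- one long assembly proof (constants, block data, existence, uniqueness)
/-- **The Chow–Lin–Palmer shadowing lemma holds** (Pilyugin1999 §1.3.4, (1.86)–(1.90), autonomous case):
proof by Pilyugin's reduction to his Theorems 1.3.1 (existence, `IsHyperbolicSequence.exists_shadow`) and
1.3.2 (uniqueness, `IsHyperbolicSequence.shadow_unique`) through the `ν`-block maps `Ψ = ψ^ν`,
`φ_m(v) = Ψ(ξ_m + v) - ξ_{m+1}`, `ξ_m = y_{mν}`, with the block hyperbolic sequence of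
`IsCLPHyperbolicSet.exists_blockSequence` (splitting at the arrival points `ψ^ν(y_{(m-1)ν})`, so that the merely
pointwise continuity of the splitting is never used), followed by interpolation inside the blocks.
[cite: Pilyugin1999, §1.3.4, (1.86)–(1.92)] -/
theorem ChowLinPalmerShadowing_holds : ChowLinPalmerShadowing := by
  intro E _ _ _ ψ T P Q N lam Δ h
  -- constants of the structure
  have hN := h.N_pos
  have hlam0 := h.lam_pos
  have hlam1 := h.lam_lt_one
  have hΔ := h.Δ_pos
  obtain ⟨L, hL1, hLM⟩ := h.exists_fderiv_bound
  have hL0 : 0 < L := zero_lt_one.trans_le hL1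
  set N₀ : ℝ := max N 1 with hN₀
  have hNN₀ : N ≤ N₀ := le_max_left _ _
  have hN₀1 : 1 ≤ N₀ := le_max_right _ _
  have hN₀0 : 0 < N₀ := zero_lt_one.trans_le hN₀1
  -- the block length `ν`: `N₀⁴ λ^ν ≤ 1/24`
  obtain ⟨ν₀, hν₀⟩ := exists_pow_lt_of_lt_one (show 0 < 1 / (24 * N₀ ^ 4) by positivity) hlam1
  set ν : ℕ := ν₀ + 1 with hν
  have hν1 : 1 ≤ ν := Nat.le_add_left 1 ν₀
  have hlamν0 : 0 ≤ lam ^ ν := pow_nonneg hlam0.le _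
  have hlamν : lam ^ ν ≤ 1 / (24 * N₀ ^ 4) := by
    calc lam ^ ν = lam ^ ν₀ * lam := pow_succ lam ν₀
      _ ≤ lam ^ ν₀ * 1 := mul_le_mul_of_nonneg_left hlam1.le (pow_nonneg hlam0.le _)
      _ ≤ 1 / (24 * N₀ ^ 4) := by rw [mul_one]; exact hν₀.le
  have hk4 : N₀ ^ 4 * lam ^ ν ≤ 1 / 24 := by
    calc N₀ ^ 4 * lam ^ ν ≤ N₀ ^ 4 * (1 / (24 * N₀ ^ 4)) := mul_le_mul_of_nonneg_left hlamν (by positivity)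
      _ = 1 / 24 := by field_simp
  obtain ⟨hk3, hk2, hk1⟩ := pow_mul_le_aux hN₀1 hlamν0 hk4
  have hνl : N₀ ^ 2 * lam ^ ν ≤ 1 / 4 := hk2.trans (by norm_num)
  have hLν1 : 1 ≤ L ^ ν := one_le_pow₀ hL1
  have hLν0 : 0 < L ^ ν := by positivity
  -- moduli of `D(ψ^ν)` at `T` (condition (5))
  obtain ⟨δ₁, hδ₁, hδ₁Δ, hmod₁⟩ := h.fderiv_iterate_modulus hLM hL1 ν (ε := 1 / (24 * N₀)) (by positivity)
  obtain ⟨δ₂, hδ₂, hδ₂Δ, hmod₂⟩ :=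
    h.fderiv_iterate_modulus hLM hL1 ν (ε := 1 / (24 * N₀ ^ 3)) (by positivity)
  have hδ₁Δ' : δ₁ ≤ Δ := (le_mul_of_one_le_left hδ₁.le hLν1).trans hδ₁Δ
  have hδ₂Δ' : δ₂ ≤ Δ := (le_mul_of_one_le_left hδ₂.le hLν1).trans hδ₂Δ
  -- constants of Theorems 1.3.1 / 1.3.2 for the block sequence: `λ' = 1/2`, `N₁ = 3N₀`, `κ N₁ = 5/8`, `L = 8N₀`
  set κ : ℝ := 5 / (24 * N₀) with hκ
  have hκ0 : 0 ≤ κ := by positivity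
  have hgreen : greenBound (1 / 2) N₀ = 3 * N₀ := by
    simp only [greenBound]; ring
  have hκN : κ * greenBound (1 / 2) N₀ < 1 := by
    rw [hgreen, hκ]
    have : 5 / (24 * N₀) * (3 * N₀) = 5 / 8 := by field_simp; ring
    rw [this]; norm_num
  have hshadow : shadowConst (1 / 2) N₀ κ = 8 * N₀ := by
    simp only [shadowConst, hgreen, hκ]
    field_simp
    ring
  set L₁ : ℝ := ν * L ^ ν with hL₁
  have hν1' : (1 : ℝ) ≤ ν := by exact_mod_cast hν1
  have hL₁1 : 1 ≤ L₁ := one_le_mul_of_one_le_of_one_le hν1' hLν1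
  have hL₁0 : 0 < L₁ := zero_lt_one.trans_le hL₁1
  set L₂ : ℝ := L ^ ν * (8 * N₀) * L₁ + L₁ with hL₂
  have hL₂0 : 0 < L₂ := by positivity
  -- `ε₀ := δ₁`
  refine ⟨δ₁, hδ₁, fun ε hε hεδ₁ => ?_⟩
  -- the choice of `d`
  set d : ℝ := min (min (Δ / L₁) (δ₁ / (8 * N₀ * L₁))) (min (δ₂ / (L ^ ν * L₁)) (ε / L₂)) with hd_def
  have hd : 0 < d := lt_min (lt_min (div_pos hΔ hL₁0) (div_pos hδ₁ (by positivity)))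
    (lt_min (div_pos hδ₂ (by positivity)) (div_pos hε hL₂0))
  have hd1 : L₁ * d ≤ Δ := by
    have : d ≤ Δ / L₁ := (min_le_left _ _).trans (min_le_left _ _)
    rwa [le_div_iff₀' hL₁0] at this
  have hd2 : 8 * N₀ * L₁ * d ≤ δ₁ := by
    have : d ≤ δ₁ / (8 * N₀ * L₁) := (min_le_left _ _).trans (min_le_right _ _)
    rwa [le_div_iff₀' (by positivity)] at this
  have hd3 : L ^ ν * L₁ * d ≤ δ₂ := by
    have : d ≤ δ₂ / (L ^ ν * L₁) := (min_le_right _ _).trans (min_le_left _ _)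
    rwa [le_div_iff₀' (by positivity)] at this
  have hd4 : L₂ * d ≤ ε := by
    have : d ≤ ε / L₂ := (min_le_right _ _).trans (min_le_right _ _)
    rwa [le_div_iff₀' hL₂0] at this
  have hL₁d₁ : L₁ * d ≤ δ₁ := by
    calc L₁ * d = 1 * (L₁ * d) := (one_mul _).symm
      _ ≤ 8 * N₀ * (L₁ * d) := mul_le_mul_of_nonneg_right (by linarith) (by positivity)
      _ = 8 * N₀ * L₁ * d := by ring
      _ ≤ δ₁ := hd2
  have hL₁d₂ : L₁ * d ≤ δ₂ := by
    calc L₁ * d = 1 * (L₁ * d) := (one_mul _).symm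
      _ ≤ L ^ ν * (L₁ * d) := mul_le_mul_of_nonneg_right hLν1 (by positivity)
      _ = L ^ ν * L₁ * d := by ring
      _ ≤ δ₂ := hd3
  refine ⟨d, hd, fun y hyT hy => ?_⟩
  /- the block data: `ξ m = y (mν)`, arrival points `xs m = ψ^ν (y ((m-1)ν))` -/
  set ξ : ℤ → E := fun m => y (m * ν) with hξ_def
  set xs : ℤ → E := fun m => ψ^[ν] (y ((m - 1) * ν)) with hxs_def
  have hξT : ∀ m, ξ m ∈ T := fun m => hyT _
  have hxsT : ∀ m, xs m ∈ T := fun m => h.iterate_mem (hyT _) ν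
  have hstep : ∀ m, xs (m + 1) = ψ^[ν] (ξ m) := fun m => by
    simp only [hxs_def, hξ_def, add_sub_cancel_right]
  have hzT : ∀ m, ψ^[ν] (xs m) ∈ T := fun m => h.iterate_mem (hxsT m) ν
  -- the pseudo-orbit follows the block orbits (Lemma 1.1.3)
  have hνd : (ν : ℝ) * L ^ ν * d ≤ Δ := hd1
  have hblock : ∀ j, j ≤ ν → ∀ k : ℤ, ‖ψ^[j] (y k) - y (k + j)‖ ≤ j * L ^ j * d :=
    h.norm_iterate_sub_pseudoOrbit_le hLM hL1 hyT hy hd.le hνd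
  have hxsξ : ∀ m, ‖xs m - ξ m‖ ≤ L₁ * d := fun m => by
    have := hblock ν le_rfl ((m - 1) * ν)
    have e : (m - 1) * (ν : ℤ) + (ν : ℕ) = m * ν := by ring
    rwa [e] at this
  -- derivative closeness between `xs m` and `ξ m`, and at the junctions `ψ^ν (xs m)`, `xs (m+1)`
  have hω : ∀ m, ‖fderiv ℝ (ψ^[ν]) (xs m) - fderiv ℝ (ψ^[ν]) (ξ m)‖ ≤ 1 / (24 * N₀ ^ 3) := fun m =>
    hmod₂ (ξ m) (hξT m) (xs m) ((hxsξ m).trans hL₁d₂)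
  have hω' : ∀ m, ‖fderiv ℝ (ψ^[ν]) (ξ m) - fderiv ℝ (ψ^[ν]) (xs m)‖ ≤ 1 / (24 * N₀) := fun m => by
    rw [norm_sub_rev]; exact hmod₁ (ξ m) (hξT m) (xs m) ((hxsξ m).trans hL₁d₁)
  have hjdist : ∀ m, ‖ψ^[ν] (xs m) - xs (m + 1)‖ ≤ δ₂ := fun m => by
    rw [hstep m]
    have h1 : L ^ ν * ‖xs m - ξ m‖ ≤ Δ :=
      (mul_le_mul_of_nonneg_left (hxsξ m) hLν0.le).trans ((le_of_eq (by ring)).trans (hd3.trans hδ₂Δ'))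
    calc ‖ψ^[ν] (xs m) - ψ^[ν] (ξ m)‖ ≤ L ^ ν * ‖xs m - ξ m‖ :=
          h.norm_iterate_sub_iterate_le_of_mem hLM hL1 (hξT m) h1 ν le_rfl
      _ ≤ L ^ ν * (L₁ * d) := mul_le_mul_of_nonneg_left (hxsξ m) hLν0.le
      _ = L ^ ν * L₁ * d := by ring
      _ ≤ δ₂ := hd3
  have hjω : ∀ m, ‖fderiv ℝ (ψ^[ν]) (ψ^[ν] (xs m)) - fderiv ℝ (ψ^[ν]) (xs (m + 1))‖ ≤
      1 / (24 * N₀ ^ 3) := fun m => hmod₂ (xs (m + 1)) (hxsT _) _ (hjdist m)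
  have hjω' : ∀ m, ‖fderiv ℝ (ψ^[ν]) (xs (m + 1)) - fderiv ℝ (ψ^[ν]) (ψ^[ν] (xs m))‖ ≤
      1 / (24 * N₀ ^ 3) := fun m => by rw [norm_sub_rev]; exact hjω m
  -- stable closeness at the junctions (no continuity of the splitting is used)
  have hsmall : N * lam ^ ν * (N * (1 + N) * lam ^ ν + N * (1 / (24 * N₀ ^ 3))) ≤ 1 / 2 := by
    have hlam1' : lam ^ ν ≤ 1 := pow_le_one₀ hlam0.le hlam1.le
    have hsq : 1 ≤ N₀ ^ 2 := one_le_pow₀ hN₀1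
    have hc : N₀ * (1 / (24 * N₀ ^ 3)) ≤ 1 := by
      rw [mul_one_div, div_le_one (by positivity)]
      nlinarith
    calc N * lam ^ ν * (N * (1 + N) * lam ^ ν + N * (1 / (24 * N₀ ^ 3)))
        ≤ N₀ * lam ^ ν * (N₀ * (1 + N₀) * lam ^ ν + N₀ * (1 / (24 * N₀ ^ 3))) := by gcongr
      _ ≤ N₀ * lam ^ ν * (N₀ * (1 + N₀) * 1 + 1) := by gcongr
      _ = (N₀ ^ 2 * lam ^ ν) * (1 + N₀) + N₀ * lam ^ ν := by ring
      _ ≤ (N₀ ^ 2 * lam ^ ν) * (N₀ + N₀) + N₀ * lam ^ ν := by gcongr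
      _ = 2 * (N₀ ^ 3 * lam ^ ν) + N₀ * lam ^ ν := by ring
      _ ≤ 2 * (1 / 24) + 1 / 24 := by gcongr
      _ ≤ 1 / 2 := by norm_num
  have hclose : ∀ {z z' : E}, z ∈ T → z' ∈ T →
      ‖fderiv ℝ (ψ^[ν]) z - fderiv ℝ (ψ^[ν]) z'‖ ≤ 1 / (24 * N₀ ^ 3) →
        ∀ e, ‖Q z (P z' e)‖ ≤ 1 / 2 * ‖e‖ := fun hz hz' hzz' e =>
    (h.norm_Q_P_apply_le hz hz' hν1 hzz' e).trans (mul_le_mul_of_nonneg_right hsmall (norm_nonneg _))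
  have hclose₁ : ∀ m, ‖(Q (ψ^[ν] (xs m))).comp (P (xs (m + 1)))‖ ≤ 1 / 2 := fun m =>
    ContinuousLinearMap.opNorm_le_bound _ (by norm_num) fun e => hclose (hzT m) (hxsT (m + 1)) (hjω m) e
  have hclose₂ : ∀ m, ‖(Q (xs (m + 1))).comp (P (ψ^[ν] (xs m)))‖ < 1 := fun m => by
    refine lt_of_le_of_lt (ContinuousLinearMap.opNorm_le_bound _ (by norm_num) fun e => ?_)
      one_half_lt_one
    exact hclose (hxsT (m + 1)) (hzT m) (hjω' m) e
  /- the block hyperbolic sequence (Pilyugin's reduction) -/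
  obtain ⟨A, B, hHS, hU, hexpU, happrox⟩ :=
    h.exists_blockSequence hNN₀ hN₀1 hν1 hνl hxsT hξT hstep hclose₁ hclose₂ hω
  -- the block maps `φ_m(v) = Ψ(ξ_m + v) - ξ_{m+1}` and the Lipschitz estimate (1.54) for `φ_m - A_m`
  set φ : ℤ → E → E := fun m v => ψ^[ν] (ξ m + v) - ξ (m + 1) with hφ_def
  have hφ0 : ∀ m, ‖φ m 0‖ ≤ L₁ * d := fun m => by
    simp only [hφ_def, add_zero, ← hstep m]
    exact hxsξ (m + 1)
  have happrox' : N₀ ^ 2 * lam ^ ν + N₀ ^ 2 * (N₀ * lam ^ ν + 1 / (24 * N₀ ^ 3)) ≤ 3 / (24 * N₀) := by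
    have e1 : N₀ ^ 2 * (N₀ * lam ^ ν + 1 / (24 * N₀ ^ 3)) = N₀ ^ 3 * lam ^ ν + 1 / (24 * N₀) := by
      field_simp
    rw [e1]
    have e2 : N₀ ^ 2 * lam ^ ν ≤ 1 / (24 * N₀) := by
      rw [le_div_iff₀ (by positivity)]
      calc N₀ ^ 2 * lam ^ ν * (24 * N₀) = 24 * (N₀ ^ 3 * lam ^ ν) := by ring
        _ ≤ 24 * (1 / 24) := by gcongr
        _ = 1 := by norm_num
    have e3 : N₀ ^ 3 * lam ^ ν ≤ 1 / (24 * N₀) := by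
      rw [le_div_iff₀ (by positivity)]
      calc N₀ ^ 3 * lam ^ ν * (24 * N₀) = 24 * (N₀ ^ 4 * lam ^ ν) := by ring
        _ ≤ 24 * (1 / 24) := by gcongr
        _ = 1 := by norm_num
    have e4 : 3 / (24 * N₀) = 1 / (24 * N₀) + 1 / (24 * N₀) + 1 / (24 * N₀) := by ring
    rw [e4]
    linarith
  have hLip : ∀ (m : ℤ) (v v' : E), ‖v‖ ≤ δ₁ → ‖v'‖ ≤ δ₁ →
      ‖(φ m v - A m v) - (φ m v' - A m v')‖ ≤ κ * ‖v - v'‖ := by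
    intro m v v' hv hv'
    have e1 : (φ m v - A m v) - (φ m v' - A m v') =
        (ψ^[ν] (ξ m + v) - ψ^[ν] (ξ m + v') - fderiv ℝ (ψ^[ν]) (ξ m) (v - v')) +
        (fderiv ℝ (ψ^[ν]) (ξ m) - fderiv ℝ (ψ^[ν]) (xs m)) (v - v') +
        (fderiv ℝ (ψ^[ν]) (xs m) (v - v') - A m (v - v')) := by
      simp only [hφ_def, map_sub, sub_apply]; abel
    have t1 : ‖ψ^[ν] (ξ m + v) - ψ^[ν] (ξ m + v') - fderiv ℝ (ψ^[ν]) (ξ m) (v - v')‖ ≤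
        1 / (24 * N₀) * ‖v - v'‖ :=
      h.norm_iterate_sub_sub_fderiv_le ν (fun b hb => hmod₁ (ξ m) (hξT m) b hb) hv hv'
    have t2 : ‖(fderiv ℝ (ψ^[ν]) (ξ m) - fderiv ℝ (ψ^[ν]) (xs m)) (v - v')‖ ≤
        1 / (24 * N₀) * ‖v - v'‖ :=
      (ContinuousLinearMap.le_opNorm _ _).trans (mul_le_mul_of_nonneg_right (hω' m) (norm_nonneg _))
    have t3 : ‖fderiv ℝ (ψ^[ν]) (xs m) (v - v') - A m (v - v')‖ ≤ 3 / (24 * N₀) * ‖v - v'‖ :=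
      (happrox m (v - v')).trans (mul_le_mul_of_nonneg_right happrox' (norm_nonneg _))
    rw [e1]
    calc _ ≤ ‖ψ^[ν] (ξ m + v) - ψ^[ν] (ξ m + v') - fderiv ℝ (ψ^[ν]) (ξ m) (v - v')‖ +
          ‖(fderiv ℝ (ψ^[ν]) (ξ m) - fderiv ℝ (ψ^[ν]) (xs m)) (v - v')‖ +
          ‖fderiv ℝ (ψ^[ν]) (xs m) (v - v') - A m (v - v')‖ := norm_add₃_le
      _ ≤ 1 / (24 * N₀) * ‖v - v'‖ + 1 / (24 * N₀) * ‖v - v'‖ + 3 / (24 * N₀) * ‖v - v'‖ :=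
          add_le_add (add_le_add t1 t2) t3
      _ = κ * ‖v - v'‖ := by rw [hκ]; ring
  /- EXISTENCE by Theorem 1.3.1 -/
  have hdL : L₁ * d ≤ δ₁ / shadowConst (1 / 2) N₀ κ := by
    rw [hshadow, le_div_iff₀ (by positivity)]
    calc L₁ * d * (8 * N₀) = 8 * N₀ * L₁ * d := by ring
      _ ≤ δ₁ := hd2
  obtain ⟨v, hvb, hvtraj⟩ := hHS.exists_shadow (φ := φ) hκ0 (by positivity) hκN hLip hφ0 hdL
  rw [hshadow] at hvb
  have hvb' : ∀ m, ‖v m‖ ≤ δ₁ := fun m =>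
    (hvb m).trans ((le_of_eq (by ring)).trans hd2)
  -- the `Ψ`-orbit `zs m = ξ m + v m` and its interpolation `x`
  set zs : ℤ → E := fun m => ξ m + v m with hzs
  have hzs_step : ∀ m, ψ^[ν] (zs m) = zs (m + 1) := fun m => by
    have := hvtraj m
    simp only [hφ_def] at this
    simp only [hzs]
    rw [← this]; abel
  set x : ℤ → E := fun k => ψ^[(k % (ν : ℤ)).toNat] (zs (k / (ν : ℤ))) with hx_def
  have hxorb : IsOrbit ψ x := isOrbit_interpolate hν1 hzs_step
  -- `x` ε-shadows `y`
  have hshad : Shadows ε x y := by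
    intro k
    obtain ⟨q, j, hjν, hk, hxk⟩ := interpolate_apply (ψ := ψ) hν1 zs k
    change x k = ψ^[j] (zs q) at hxk
    rw [hxk, hk]
    have hjν' : j ≤ ν := hjν.le
    have hzq : ‖zs q - ξ q‖ ≤ 8 * N₀ * (L₁ * d) := by
      simp only [hzs, add_sub_cancel_left]; exact hvb q
    have t1 : ‖ψ^[j] (zs q) - ψ^[j] (ξ q)‖ ≤ L ^ ν * (8 * N₀ * (L₁ * d)) := by
      have hΔ' : L ^ ν * ‖zs q - ξ q‖ ≤ Δ := by
        calc L ^ ν * ‖zs q - ξ q‖ ≤ L ^ ν * (8 * N₀ * (L₁ * d)) := mul_le_mul_of_nonneg_left hzq hLν0.le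
          _ ≤ L₂ * d := by rw [hL₂]; nlinarith [mul_nonneg hL₁0.le hd.le]
          _ ≤ Δ := hd4.trans (hεδ₁.le.trans hδ₁Δ')
      calc ‖ψ^[j] (zs q) - ψ^[j] (ξ q)‖ ≤ L ^ j * ‖zs q - ξ q‖ :=
            h.norm_iterate_sub_iterate_le_of_mem hLM hL1 (hξT q) hΔ' j hjν'
        _ ≤ L ^ ν * (8 * N₀ * (L₁ * d)) :=
            mul_le_mul (pow_le_pow_right₀ hL1 hjν') hzq (norm_nonneg _) hLν0.le
    have t2 : ‖ψ^[j] (ξ q) - y (q * ν + j)‖ ≤ L₁ * d := by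
      calc ‖ψ^[j] (ξ q) - y (q * ν + j)‖ ≤ j * L ^ j * d := hblock j hjν' (q * ν)
        _ ≤ ν * L ^ ν * d := by
            apply mul_le_mul_of_nonneg_right _ hd.le
            exact mul_le_mul (by exact_mod_cast hjν') (pow_le_pow_right₀ hL1 hjν') (by positivity)
              (Nat.cast_nonneg _)
        _ = L₁ * d := by rw [hL₁]
    calc ‖ψ^[j] (zs q) - y (q * ν + j)‖
        = ‖(ψ^[j] (zs q) - ψ^[j] (ξ q)) + (ψ^[j] (ξ q) - y (q * ν + j))‖ := by rw [sub_add_sub_cancel]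
      _ ≤ L ^ ν * (8 * N₀ * (L₁ * d)) + L₁ * d := (norm_add_le _ _).trans (add_le_add t1 t2)
      _ = L₂ * d := by rw [hL₂]; ring
      _ ≤ ε := hd4
  /- UNIQUENESS by Theorem 1.3.2 -/
  refine ⟨x, ⟨hxorb, hshad⟩, ?_⟩
  rintro x' ⟨hx'orb, hx'shad⟩
  set v' : ℤ → E := fun m => x' (m * ν) - ξ m with hv'
  have hv'b : ∀ m, ‖v' m‖ ≤ δ₁ := fun m => (hx'shad (m * ν)).trans hεδ₁.le
  have hv'traj : ∀ m, φ m (v' m) = v' (m + 1) := fun m => by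
    simp only [hφ_def, hv', add_sub_cancel]
    rw [← hx'orb.apply_add_natCast (m * ν) ν]
    congr 2; ring
  have heq := hHS.shadow_unique hU hexpU hκ0 hκN hLip hφ0 hvb' hv'b hvtraj hv'traj
  -- hence `x'` agrees with `x` at the block starts, hence everywhere
  have hblocks : ∀ q : ℤ, x' (q * ν) = zs q := fun q => by
    have := congrFun heq q
    simp only [hzs, this, hv', add_sub_cancel]
  funext k
  obtain ⟨q, j, -, hk, hxk⟩ := interpolate_apply (ψ := ψ) hν1 zs k
  change x k = ψ^[j] (zs q) at hxk
  rw [hxk, hk, hx'orb.apply_block q ν j, hblocks q]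

end Main

end Literature.Dynamics.Hyperbolic

end
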